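import Summits.BirchSwinnertonDyer.BirchSwinnertonDyer.Theses.SignedLowerHalves
import Summits.BirchSwinnertonDyer.BirchSwinnertonDyer.Theorems.SignedLowerHalvesKobayashiLowerHalfLargeImageMuFloorSupply
import Summits.BirchSwinnertonDyer.BirchSwinnertonDyer.Theorems.SignedLowerHalvesKobayashiLowerHalfLargeImageHorocycleMuDoor
import HarnessLib

/-!
# Route `SignedLowerHalves`, crux 3 `KobayashiLowerHalfLargeImage` (item stmt-BirchSwinnertonDyer-19001):
# line `horocycle_mu_floor` with EVERY binder a named object — crux 3 BY NAME ⟸ {λ-part (external), B⁰, h5, h3};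
# at `p = 3`: `∃ ε, KobayashiLowerDivisibility W 3 ε` ⟸ {λ-part at the pair, Mazur's period fact h3} ONLY
# (cell `bsd-ssimc`, width seat `bsd-line-slh-p1-w6` gen 0; `--supports 19001`; CALIBRATION ONLY; imports the route file)

HONEST FRAMING.  The crux is OPEN and nothing here proves it; BSD is not proved by any of this.  This file composes
two landed helper files of the same afternoon: this seat's `…LargeImageMuFloorSupply` (p647857; composition shape of
`…LargeImageMuFloorCrux`, p648373, re-proved inline so that this file imports no module of the Theses cone: the line's
composition with its μ-half supplied by the tree — `p = 3` input-free via THEOREM B / Vaserstein, `p ≥ 5` from Conjecture B⁰) and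
width seat w2 g5's `…LargeImageHorocycleMuDoor` (`HorocycleMuDoor.exists_eq_C_mul_of_pInverted` = the line's `MuUpgrade`
PROVED; `HorocycleMuDoor.periodUnit_of_named_facts` = the line's `PeriodUnit` from the PUBLISHED period facts
`h5 = realPeriodRat_eq_unit_mul_plusPeriod` (Greenberg–Vatsal 2000 §3 Rem. 3.4, `p ≥ 5`) and
`h3 = realPeriodRat_eq_unit_mul_plusPeriod_three` (Mazur 1978 Cor. 4.1, `p = 3`)).  Result: the horocycle line's
crux-by-name composition with NO hypothesis left in «line shape» — the binders are the external λ-part (OPEN), the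
conjecture B⁰ (OPEN, `p ≥ 5` only) and two published named facts; and at `p = 3` the crux's conclusion at a pair is
EXACTLY its `p`-inverted λ-part modulo Mazur's period fact.

CALIBRATION / SUPPORT ONLY (pen rule D34-4 (3)): never an input to a registered stub, a `closes`, or a by-name close of
item 19001 (line of record `kurihara_rigidity`; `horocycle_mu_floor` is unregistered, W-79).

References: [Kobayashi2003] Conjecture (p. 2), Thm. 3.2; [GreenbergVatsal2000] §3 Rem. 3.4, p. 2 (1)–(2); [Mazur1978]
Cor. 4.1; [PollackWeston2011] Thm. 4.1 (1); [Vaserstein1972SL2] Theorem; [Manin1972] Prop. 1.4 (vocabulary of B⁰).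
-/

-- D-0017: single-problem summit, the namespace repeats the problem name by design.
set_option linter.dupNamespace false
set_option autoImplicit false

noncomputable section

open scoped Classical MatrixGroups ModularForm

open CongruenceSubgroup WeierstrassCurve Literature.NumberTheory.EllipticCurves
  Literature.NumberTheory.EllipticCurves.ModularForms
  Literature.NumberTheory.EllipticCurves.Kobayashi2003 Literature.NumberTheory.EllipticCurves.GreenbergVatsal2000
  Literature.NumberTheory.EllipticCurves.Rank1Residual ZpExtension
  Summit.BirchSwinnertonDyer.Rank1Residual.Supersingular

namespace Summit.BirchSwinnertonDyer.BirchSwinnertonDyer.Theorems.LargeImageMuFloorCruxOfFacts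

open Summit.BirchSwinnertonDyer.BirchSwinnertonDyer.Cruxes.AnalyticMuZeroX9.TeichSpan (TeichSpanGenAll)
open Summit.BirchSwinnertonDyer.BirchSwinnertonDyer.Theorems.LargeImageMuFloor
  (signedMuFloor_of_teichSpanGenAll signedMuFloor_three)
open Summit.BirchSwinnertonDyer.BirchSwinnertonDyer.Theorems.HorocycleMuDoor
  (exists_eq_C_mul_of_pInverted periodUnit_of_named_facts)
open Summit.BirchSwinnertonDyer.BirchSwinnertonDyer.Theorems.SmallImageCycWindingMuThree
  (hasIrreducibleModPGaloisRep_three_of_frobeniusTrace_eq_zero)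

/-- **Crux 3 BY NAME ⟸ {λ-part with `p` inverted for both signs, Conjecture B⁰, the two published period facts}.**
Hypotheses: `h5`, `h3` — the PUBLISHED named facts `realPeriodRat_eq_unit_mul_plusPeriod[_three]` (period ratio a
`p`-unit at a good prime with `E[p]` irreducible; irreducibility is automatic at a supersingular prime, Serre Prop. 12);
`hB` — Conjecture B⁰ `TeichSpanGenAll` (OPEN; used only at `p ≥ 5`); `hlam` — the line's `LambdaLowerDivisibility` body
for both signs on the crux's class (EXTERNAL, OPEN).  The line's `MuUpgrade` is w2 g5's PROVED
`HorocycleMuDoor.exists_eq_C_mul_of_pInverted`; its `PeriodUnit` is `HorocycleMuDoor.periodUnit_of_named_facts h5 h3`; its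
μ-half is `LargeImageMuFloor.signedMuFloor_of_teichSpanGenAll` (p647857).  CALIBRATION ONLY.
[cite: Kobayashi2003, Conjecture (Main Conjecture) (p. 2)] [cite: GreenbergVatsal2000, §3, Remark 3.4] [cite: Mazur1978, Cor. 4.1] -/
theorem kobayashiLowerHalfLargeImage_of_lambdaPart_of_teichSpanGenAll_of_periodFacts
    (h5 : realPeriodRat_eq_unit_mul_plusPeriod) (h3 : realPeriodRat_eq_unit_mul_plusPeriod_three)
    (hB : TeichSpanGenAll)
    (hlam : ∀ (W : WeierstrassCurve ℚ) [W.IsElliptic] [W.IsGloballyMinimal] (p : ℕ) [Fact p.Prime],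
      p ≠ 2 → ClassX7 W p → ¬ W.HasCM → W.frobeniusTrace p = 0 → Surj W p → ∀ ε : ℤˣ,
      ∀ (κ : ZpExtension ℚ p) (γ : Field.absoluteGaloisGroup ℚ),
          κ.IsCyclotomic → κ.IsTopGenerator γ → IsCyclotomicVariable p γ →
        ∀ [NeZero (W.conductorNorm ℤ)] (f : CuspForm (Gamma0 (W.conductorNorm ℤ)) 2),
          IsNewformOf W f → ∀ (ϖ : ℚ), (ϖ : ℝ) * W.realPeriodRat = plusPeriod f →
        ∀ (Lplus Lminus : IwasawaAlgebra p), IsPollackPair f p Lplus Lminus →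
        ∀ (D : SignedSelmerDualData W κ γ ε),
          ∃ (g h : IwasawaAlgebra p) (m : ℕ), D.charIdeal = Ideal.span {g} ∧
            iwasawaToPowerSeries p (PowerSeries.C ((p : ℤ_[p]) ^ m) * g) =
              PowerSeries.C (ϖ : ℚ_[p]) * iwasawaToPowerSeries p (kobayashiL ε Lplus Lminus * h)) :
    Summit.BirchSwinnertonDyer.BirchSwinnertonDyer.Theses.SignedLowerHalves.KobayashiLowerHalfLargeImage := by
  intro W _ _ p _ hp hX7 hCM hap hS
  obtain ⟨ε, hε⟩ := signedMuFloor_of_teichSpanGenAll (W := W) hB hp hX7.1.1 hap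
  refine ⟨ε, ?_⟩
  intro κ γ hκ hγ hγ' _ f hf ϖ hϖ Lplus Lminus hL D
  obtain ⟨g, h, m, hg, hι⟩ :=
    hlam W p hp hX7 hCM hap hS ε κ γ hκ hγ hγ' f hf ϖ hϖ Lplus Lminus hL D
  obtain ⟨h', hh'⟩ := exists_eq_C_mul_of_pInverted ϖ (kobayashiL ε Lplus Lminus) g h m
    (periodUnit_of_named_facts h5 h3 W p hp hX7.1.1 hX7.1.2 f hf ϖ hϖ) (hε f hf Lplus Lminus hL) hι
  exact ⟨g, h', hg, hh'⟩

/-- **At `p = 3`: `∃ ε, KobayashiLowerDivisibility W 3 ε` ⟸ the `p`-inverted λ-part at the pair, modulo Mazur's period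
fact ONLY.**  For `W/ℚ` globally minimal with good reduction at `p = 3` and `a₃ = 0` (no class / CM / image hypothesis):
granted the PUBLISHED named fact `h3 = realPeriodRat_eq_unit_mul_plusPeriod_three` (Mazur 1978 Cor. 4.1 ∘ Greenberg–Vatsal
Rem. 3.4), the `p`-inverted Eisenstein divisibility for both signs at this pair (`hlam`, the line's
`LambdaLowerDivisibility W 3 ε` body; EXTERNAL) gives Kobayashi's Eisenstein half for SOME sign.  The μ-half is the
tree's input-free `LargeImageMuFloor.signedMuFloor_three` (THEOREM B on Vaserstein's theorem), the μ-upgrade is w2 g5's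
`HorocycleMuDoor.exists_eq_C_mul_of_pInverted`, irreducibility of `E[3]` is Serre's Prop. 12.  So on the `p = 3` rows of X7
the crux's conclusion IS its λ-part, modulo one published fact.  CALIBRATION ONLY.
[cite: Kobayashi2003, Conjecture (Main Conjecture) (p. 2)] [cite: Mazur1978, Cor. 4.1] [cite: GreenbergVatsal2000, §3, Remark 3.4]
[cite: Serre1972, §1.11 Prop. 12] -/
theorem exists_kobayashiLowerDivisibility_three_of_lambdaPart_of_periodFact
    (h3 : realPeriodRat_eq_unit_mul_plusPeriod_three)
    (W : WeierstrassCurve ℚ) [W.IsElliptic] [W.IsGloballyMinimal] (p : ℕ) [Fact p.Prime] (hp3 : p = 3)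
    (hgood : W.HasGoodReductionAtPrime p) (hap : W.frobeniusTrace p = 0)
    (hlam : ∀ ε : ℤˣ, ∀ (κ : ZpExtension ℚ p) (γ : Field.absoluteGaloisGroup ℚ),
          κ.IsCyclotomic → κ.IsTopGenerator γ → IsCyclotomicVariable p γ →
        ∀ [NeZero (W.conductorNorm ℤ)] (f : CuspForm (Gamma0 (W.conductorNorm ℤ)) 2),
          IsNewformOf W f → ∀ (ϖ : ℚ), (ϖ : ℝ) * W.realPeriodRat = plusPeriod f →
        ∀ (Lplus Lminus : IwasawaAlgebra p), IsPollackPair f p Lplus Lminus →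
        ∀ (D : SignedSelmerDualData W κ γ ε),
          ∃ (g h : IwasawaAlgebra p) (m : ℕ), D.charIdeal = Ideal.span {g} ∧
            iwasawaToPowerSeries p (PowerSeries.C ((p : ℤ_[p]) ^ m) * g) =
              PowerSeries.C (ϖ : ℚ_[p]) * iwasawaToPowerSeries p (kobayashiL ε Lplus Lminus * h)) :
    ∃ ε : ℤˣ, KobayashiLowerDivisibility W p ε := by
  subst hp3
  obtain ⟨ε, hε⟩ := signedMuFloor_three (W := W) 3 rfl hgood hap
  have hirr : W.HasIrreducibleModPGaloisRep 3 := hasIrreducibleModPGaloisRep_three_of_frobeniusTrace_eq_zero W hgood hap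
  refine ⟨ε, ?_⟩
  intro κ γ hκ hγ hγ' _ f hf ϖ hϖ Lplus Lminus hL D
  obtain ⟨g, h, m, hg, hι⟩ := hlam ε κ γ hκ hγ hγ' f hf ϖ hϖ Lplus Lminus hL D
  obtain ⟨u, hu, hΩ⟩ := h3 W hgood hirr f hf
  obtain ⟨h', hh'⟩ := exists_eq_C_mul_of_pInverted ϖ (kobayashiL ε Lplus Lminus) g h m
    (padicValRat_periodRatio_eq_zero_of_eq_unit_mul W 3 f hu hΩ ϖ hϖ) (hε f hf Lplus Lminus hL) hι
  exact ⟨g, h', hg, hh'⟩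

end Summit.BirchSwinnertonDyer.BirchSwinnertonDyer.Theorems.LargeImageMuFloorCruxOfFacts

end
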